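import Summits.BirchSwinnertonDyer.BirchSwinnertonDyer.Theorems.MordellShaFreeCutKatoZetaRoadFactsCensus
import Summits.BirchSwinnertonDyer.BirchSwinnertonDyer.Theorems.MordellShaFreeCutNamedPropsCensus
import Summits.BirchSwinnertonDyer.BirchSwinnertonDyer.Theorems.CongruentShaFreeCutIntegralH1RankLeOne
import Literature.NumberTheory.EllipticCurves.Kato2004.IwasawaH1ProjZeroKernelProofs
import Literature.NumberTheory.EllipticCurves.Kato2004.IwasawaCohomologyExistsProofs
import Literature.NumberTheory.EllipticCurves.Kato2004.LocPKernelRankOneProofs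
import HarnessLib

set_option linter.dupNamespace false
set_option autoImplicit false

/-! # Route `MordellShaFreeCut` (rung S2b) — crux B `AnalyticRankOneOfRankOneFiniteShaThree`
# (stmt-BirchSwinnertonDyer-19160): the Kato–zeta road's census AFTER (α) — crux B BY NAME from SEVEN NAMED
# FACTS (six refereed theorems ∧ `Kato2004.thm12_4`) and ONE research statement `PRFormulaAtThreeH2`

Cell `bsd-cn100`, prover seat `bsd-cn100-s2b-c3` (g17). THEOREMS ONLY — one-line compositions of LANDED tree
theorems; 0 `def`, 0 new named fact. Supports, does not close, stmt-BirchSwinnertonDyer-19160. The successor of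
this seat's eleven-fact census `MordellShaFreeCutKatoZetaRoadFactsCensus.cruxB_of_namedFacts_of_prFormulaH2`
(p472508): of its five reading-grade Kato hypotheses, FOUR are now tree theorems and are DISCHARGED here —
`Kato2004.nonempty_iwasawaH1Data` by `nonempty_iwasawaH1Data_holds` (cell bsd-smallim, `IwasawaCohomologyExistsProofs`),
`Kato2004.nonempty_iwasawaH2Data` by **`nonempty_iwasawaH2Data_holds`** (Kato (14.14.1) injectivity on the pinned
`𝐇¹_Γ(T_pW)`: cell bsd-potss-rkm g8, `IwasawaH1ProjZeroKernelProofs`, p510488, 2026-08-27 — the (α) landing that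
occasions this file), `Kato2004.finite_descentCokernel_of_rankOne` by bsd-cn100-s2-c3 g11's (R1) theorem
`CongruentShaFreeCutIntegralH1RankLeOne.finite_descentCokernel_of_rankOne_of_nonempty_of_thm12_4` (p508547) fed with
`nonempty_iwasawaH2Data_holds`, and `Kato2004.locP_kernel_isTorsion_of_rankOne` by `locP_kernel_isTorsion_of_rankOne_holds`
(`LocPKernelRankOneProofs`, p484260). What remains displayed is exactly the conjunct list of the stub
`stub_refereedInputs` of the line's v1g skeleton (RI7: `p_parity`, `ModularForms.exists_isNewformOf`,
`HoffsteinLuo1997_exists_twist_L_one_ne_zero`, `kato_finite_of_L_one_ne_zero`, `exists_isHeegnerPoint`,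
`analyticRankEK_eq_one_iff_heegner_nonTorsion`, `Kato2004.thm12_4`) and the research stub's type `PRFormulaAtThreeH2`
— so «crux B ⟸ 7 citation-borne facts + 1 research statement» is one machine-checked signature
(`cruxB_of_sevenFacts_of_prFormulaH2`), also in the bundled shape of the stub (`cruxB_of_RI7_of_prFormulaH2`), and the
(R+K) reading at `j = 0`, `p = 3` costs ONE named fact (`readingRK_jZero_three_of_thm12_4`).

HONEST FRAMING: nothing here proves crux B, the leaf `rankOne_threeConverse_mordellCurve`, Sylvester's problem or
any case of BSD; `thm12_4` (Kato (12.2.1) + Thm. 12.4 (2), rank-one clause) and the six refereed theorems stay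
citation-borne, `PRFormulaAtThreeH2` stays OPEN (Perrin-Riou's formula for Kato's zeta element at the ADDITIVE prime
`3` of the `j = 0` curves; nearest refereed prior art Bertolini–Darmon–Venerucci 2022 Thm. A, semistable odd `p`;
Burungale–Kobayashi–Ota 2024 / [ABS] App. A Thm. 10.8 (a), good supersingular `p`). PARTITION: none — RANK axis.
Build rule (H): concludes the route decl by name through the S2b-cone file `MordellShaFreeCutKatoZetaRoadFactsCensus`;
the other imports are Theses-free (`CongruentShaFreeCutIntegralH1RankLeOne` is `W`,`p`-generic despite its name).

References: [AlpogeBhargavaShnidman2022] App. A Thm. 10.1, Thm. 10.6, Thm. 10.8, §10.1.3; [Kato2004Asterisque]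
§12.2 (12.2.1), Thm. 12.4, (14.9.3), §14.14 (14.14.1)–(14.14.2), Cor. 14.3; [BurungaleTian2026] Thm. 2.6, Thm. 3.1;
[BertoliniDarmonVenerucci2022] Thm. A; [GrossZagier1986] Thm. I.6.3; [DokchitserDokchitserAnnals2010] Thm. 1.4.
-/

noncomputable section

open scoped Classical

open WeierstrassCurve NumberField IsDedekindDomain Field Literature.NumberTheory.EllipticCurves
  Literature.NumberTheory.EllipticCurves.Kato2004 Literature.NumberTheory.EllipticCurves.IwasawaAlgebra
  Literature.NumberTheory.EllipticCurves.Kato2004.EulerSystemValues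
  Literature.NumberTheory.GaloisRepresentations
  Summit.BirchSwinnertonDyer.Rank1Residual.Additive
  Summit.BirchSwinnertonDyer.BirchSwinnertonDyer.Theses.MordellShaFreeCut
  Summit.BirchSwinnertonDyer.BirchSwinnertonDyer.Theorems.CongruentShaFreeCutKatoDescentDatumOfH2
  Summit.BirchSwinnertonDyer.BirchSwinnertonDyer.Theorems.MordellShaFreeCutKatoZetaRoadPinnedH2

namespace Summit.BirchSwinnertonDyer.BirchSwinnertonDyer.Theorems.MordellShaFreeCutKatoZetaRoadSevenFactsCensus

/-- **(R+K) at `j = 0`, `p = 3` from ONE named fact.** For every globally minimal elliptic `W/ℚ` with `j(W) = 0`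
there is a v2-PINNED Kato descent datum of `(W, 3)` satisfying Kato's Main Conjecture 12.10 in `Λ ⊗ ℚ₃`
(`3^a · char_Λ 𝐇² = 3^b · char_Λ (𝐇¹/Λz)`), GIVEN `Kato2004.thm12_4` alone: bsd-cn100-ty g8's
`CongruentShaFreeCutKatoZetaRoadReadings.readingRK_jZero_three_of_facts` (z chosen by char-ideal algebra) with its
hypotheses `nonempty_iwasawaH1Data` and `nonempty_iwasawaH2Data` DISCHARGED by the tree theorems
`nonempty_iwasawaH1Data_holds` and `nonempty_iwasawaH2Data_holds` (p510488). CONDITIONAL on `thm12_4`; closes nothing.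
[cite: Kato2004Asterisque, §12.2 (12.2.1) (p. 220), Thm. 12.4 (p. 221), §14.14 (14.14.1) (p. 243)]
[cite: BurungaleTian2026, Thm. 2.6 (CM main conjecture ⊗ ℚ, every p)] -/
theorem readingRK_jZero_three_of_thm12_4 (h12 : thm12_4) :
    ∀ (W : WeierstrassCurve ℚ) [W.IsElliptic] [W.IsGloballyMinimal]
      [ContinuousSMul ℤ_[3] (W.tateModule 3)], W.j = 0 →
        ∃ D : KatoDescentDatum 3, Nonempty (KatoDescentDatumPinH2 W 3 D) ∧
          ∃ a b : ℕ,
            Ideal.span {((3 : ℕ) : IwasawaAlgebra 3) ^ a} * Module.charIdeal (IwasawaAlgebra 3) D.H2 =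
              Ideal.span {((3 : ℕ) : IwasawaAlgebra 3) ^ b} *
                Module.charIdeal (IwasawaAlgebra 3) (D.H ⧸ (IwasawaAlgebra 3) ∙ D.z) :=
  CongruentShaFreeCutKatoZetaRoadReadings.readingRK_jZero_three_of_facts nonempty_iwasawaH1Data_holds
    nonempty_iwasawaH2Data_holds h12

/-- **Crux B `AnalyticRankOneOfRankOneFiniteShaThree` (stmt-BirchSwinnertonDyer-19160) from SEVEN NAMED FACTS and
Perrin-Riou's formula** — the census of the Kato–zeta road after (α): six refereed theorems (`3`-parity,
modularity, Hoffstein–Luo, Kato finiteness, Heegner points, Gross–Zagier + Kolyvagin), ONE reading-grade typed Kato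
statement (`thm12_4`), and the ONE research statement `PRFormulaAtThreeH2`. Proof: the road's composition
`MordellShaFreeCutKatoZetaRoadPinnedH2.cruxB_of_prFormulaH2_of_fact31` (p467387) with (R+K) :=
`readingRK_jZero_three_of_thm12_4 h12` (above; (α) p510488 inside), (3.1′) `h31 :=
CongruentShaFreeCutIntegralH1RankLeOne.finite_descentCokernel_of_rankOne_of_nonempty_of_thm12_4 nonempty_iwasawaH2Data_holds h12`
(bsd-cn100-s2-c3 g11's (R1) theorem, p508547) and (3.1″) := `CongruentShaFreeCutKatoReading31b.reading31b_three_of_fact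
locP_kernel_isTorsion_of_rankOne_holds` (p471256 over p484260) — the same term as the eleven-fact census
`MordellShaFreeCutKatoZetaRoadFactsCensus.cruxB_of_namedFacts_of_prFormulaH2` (p472508) with `h1`, `h2`, `h31`, `h31b`
instantiated by the tree theorems. CONDITIONAL on the eight displayed hypotheses; closes nothing.
[cite: AlpogeBhargavaShnidman2022, App. A Thm. 10.1, Thm. 10.6, Thm. 10.8, §10.1.3 (pp. 33–34)]
[cite: Kato2004Asterisque, Thm. 12.4 (p. 221), (14.9.3) (p. 240), §14.14 (p. 243), Cor. 14.3 (p. 235)]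
[cite: BertoliniDarmonVenerucci2022, Thm. A (nearest refereed prior art of the formula: semistable odd p)] -/
theorem cruxB_of_sevenFacts_of_prFormulaH2
    (hpar : ∀ (W : WeierstrassCurve ℚ) [W.IsElliptic] (p : ℕ) [Fact p.Prime], p_parity W p)
    (hmod : ModularForms.exists_isNewformOf) (hHL : HoffsteinLuo1997_exists_twist_L_one_ne_zero)
    (hKato : ∀ (W : WeierstrassCurve ℚ) [W.IsElliptic] (p : ℕ) [Fact p.Prime],
      kato_finite_of_L_one_ne_zero W p)
    (hHP : ∀ (W : WeierstrassCurve ℚ) (K : Type) [Field K] [NumberField K],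
      exists_isHeegnerPoint W K)
    (hGZ : ∀ (W : WeierstrassCurve ℚ) (N : ℕ) [NeZero N] (K : Type) [Field K] [NumberField K],
      analyticRankEK_eq_one_iff_heegner_nonTorsion W N K)
    (h12 : thm12_4) (hPR : PRFormulaAtThreeH2) :
    AnalyticRankOneOfRankOneFiniteShaThree :=
  cruxB_of_prFormulaH2_of_fact31 hpar hmod hHL hKato hHP hGZ (readingRK_jZero_three_of_thm12_4 h12)
    (CongruentShaFreeCutIntegralH1RankLeOne.finite_descentCokernel_of_rankOne_of_nonempty_of_thm12_4
      nonempty_iwasawaH2Data_holds h12)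
    (CongruentShaFreeCutKatoReading31b.reading31b_three_of_fact locP_kernel_isTorsion_of_rankOne_holds) hPR

/-- **The v1g skeleton's composition as a tree theorem**: crux B from the 7-conjunct bundle of the stub
`stub_refereedInputs` of line `kato-zeta-perrin-riou` in its v1g shape (the six refereed facts ∧ `thm12_4`, token
for token) and `PRFormulaAtThreeH2` — so a proof of the research formula closes crux B in one line modulo the
citation-borne bundle, with no Kato construction/descent fact left among the hypotheses except Thm. 12.4 itself.
CONDITIONAL; closes nothing.
[cite: AlpogeBhargavaShnidman2022, App. A Thm. 10.1 and §10.1.3 (pp. 33–34)] [cite: Kato2004Asterisque, Thm. 12.4, (14.9.3), §14.14] -/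
theorem cruxB_of_RI7_of_prFormulaH2
    (RI : (∀ (W : WeierstrassCurve ℚ) [W.IsElliptic] (p : ℕ) [Fact p.Prime], p_parity W p) ∧
      ModularForms.exists_isNewformOf ∧
      HoffsteinLuo1997_exists_twist_L_one_ne_zero ∧
      (∀ (W : WeierstrassCurve ℚ) [W.IsElliptic] (p : ℕ) [Fact p.Prime],
        kato_finite_of_L_one_ne_zero W p) ∧
      (∀ (W : WeierstrassCurve ℚ) (K : Type) [Field K] [NumberField K], exists_isHeegnerPoint W K) ∧
      (∀ (W : WeierstrassCurve ℚ) (N : ℕ) [NeZero N] (K : Type) [Field K] [NumberField K],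
        analyticRankEK_eq_one_iff_heegner_nonTorsion W N K) ∧
      thm12_4)
    (hPR : PRFormulaAtThreeH2) :
    AnalyticRankOneOfRankOneFiniteShaThree :=
  cruxB_of_sevenFacts_of_prFormulaH2 RI.1 RI.2.1 RI.2.2.1 RI.2.2.2.1 RI.2.2.2.2.1 RI.2.2.2.2.2.1
    RI.2.2.2.2.2.2 hPR

/-! ## §2 (appended, same seat g17) The JOINED road after (α): crux B ⟸ NINE named facts + `BDPWaldspurgerFormula 3` + (ERL₃)

The S2b census of record `MordellShaFreeCutNamedPropsCensus` (p497809, §4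
`cruxB_of_namedFacts_of_anyLevel_of_bdp2013_of_waldspurger_of_reciprocity`) displays, beside the six refereed theorems and
{(T1) `Hsieh2014.thmA_exists_isHsiehLFunction_unrPeriod_anyLevel`, BDP13 `bertoliniDarmonPrasanna2013_centralValue_reciprocity`},
the Kato block `nonempty_iwasawaH2Data ∧ thm12_4 ∧ finite_descentCokernel_of_rankOne` (v1e/RI9 shape) and the two research
`Prop`s `BDPWaldspurgerFormula 3` (value) and `ThreeAdicKatoBDPReciprocity` (ERL₃). With (α) p510488 and (R1) p508547 the Kato
block shrinks to `thm12_4` alone, as on the kato-zeta road above (one new import: `MordellShaFreeCutNamedPropsCensus`, S2b cone). -/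

/-- **Crux B ⟸ NINE citation-borne named facts {six refereed theorems; `thm12_4`; (T1); BDP13} + `BDPWaldspurgerFormula 3` +
(ERL₃) `ThreeAdicKatoBDPReciprocity`** — p497809's §4 theorem with `h2 := nonempty_iwasawaH2Data_holds` (p510488) and `h31 :=`
bsd-cn100-s2-c3 g11's (R1) corollary fed with it (p508547). Every hypothesis is ONE named `Prop` of the tree; the research
content of crux B on the joined road BY NAME is {`BDPWaldspurgerFormula 3`, (ERL₃)} modulo nine citation-borne facts (was eleven).
CONDITIONAL; closes nothing.
[cite: AlpogeBhargavaShnidman2022, App. A Thm. 10.1 and Thm. 10.8 (pp. 33–34)] [cite: Kato2004Asterisque, Thm. 12.4, (14.9.3), §14.14]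
[cite: BertoliniDarmonPrasanna2013, Thm. 5.13 (shape) and Thm. 5.5] [cite: Hsieh2014, Thm. A p. 712] -/
theorem cruxB_of_nineFacts_of_anyLevel_of_bdp2013_of_waldspurger_of_reciprocity
    (hpar : ∀ (W : WeierstrassCurve ℚ) [W.IsElliptic] (p : ℕ) [Fact p.Prime], p_parity W p)
    (hmod : ModularForms.exists_isNewformOf) (hHL : HoffsteinLuo1997_exists_twist_L_one_ne_zero)
    (hKato : ∀ (W : WeierstrassCurve ℚ) [W.IsElliptic] (p : ℕ) [Fact p.Prime],
      kato_finite_of_L_one_ne_zero W p)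
    (hHP : ∀ (W : WeierstrassCurve ℚ) (K : Type) [Field K] [NumberField K],
      exists_isHeegnerPoint W K)
    (hGZ : ∀ (W : WeierstrassCurve ℚ) (N : ℕ) [NeZero N] (K : Type) [Field K] [NumberField K],
      analyticRankEK_eq_one_iff_heegner_nonTorsion W N K)
    (h12 : thm12_4) (hT1 : Hsieh2014.thmA_exists_isHsiehLFunction_unrPeriod_anyLevel)
    (hBDP : bertoliniDarmonPrasanna2013_centralValue_reciprocity)
    (hW : MordellShaFreeCutBDPWaldspurgerFormula.BDPWaldspurgerFormula 3)
    (hERL : MordellShaFreeCutKatoBDPReciprocity.ThreeAdicKatoBDPReciprocity) :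
    AnalyticRankOneOfRankOneFiniteShaThree :=
  MordellShaFreeCutNamedPropsCensus.cruxB_of_namedFacts_of_anyLevel_of_bdp2013_of_waldspurger_of_reciprocity
    hpar hmod hHL hKato hHP hGZ nonempty_iwasawaH2Data_holds h12
    (CongruentShaFreeCutIntegralH1RankLeOne.finite_descentCokernel_of_rankOne_of_nonempty_of_thm12_4
      nonempty_iwasawaH2Data_holds h12)
    hT1 hBDP hW hERL

/-- **The v1g bundle (RI7, token for token) ∧ {(T1), BDP13} ∧ `BDPWaldspurgerFormula 3` ∧ (ERL₃) ⟹ crux B** — the RI7 twin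
of p497809's §2 `cruxB_of_refereedInputs_of_anyLevel_of_bdp2013_of_waldspurger_of_reciprocity` (which takes the v1e/RI9 bundle):
the registered kato-zeta stub in its v1g shape composes with the BDP road's research inputs as well. CONDITIONAL; closes nothing.
[cite: AlpogeBhargavaShnidman2022, App. A Thm. 10.1 and §10.1.3 (pp. 33–34)] [cite: BertoliniDarmonPrasanna2013, Thm. 5.13 (shape) and Thm. 5.5] -/
theorem cruxB_of_RI7_of_anyLevel_of_bdp2013_of_waldspurger_of_reciprocity
    (RI : (∀ (W : WeierstrassCurve ℚ) [W.IsElliptic] (p : ℕ) [Fact p.Prime], p_parity W p) ∧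
      ModularForms.exists_isNewformOf ∧
      HoffsteinLuo1997_exists_twist_L_one_ne_zero ∧
      (∀ (W : WeierstrassCurve ℚ) [W.IsElliptic] (p : ℕ) [Fact p.Prime],
        kato_finite_of_L_one_ne_zero W p) ∧
      (∀ (W : WeierstrassCurve ℚ) (K : Type) [Field K] [NumberField K], exists_isHeegnerPoint W K) ∧
      (∀ (W : WeierstrassCurve ℚ) (N : ℕ) [NeZero N] (K : Type) [Field K] [NumberField K],
        analyticRankEK_eq_one_iff_heegner_nonTorsion W N K) ∧
      thm12_4)
    (hT1 : Hsieh2014.thmA_exists_isHsiehLFunction_unrPeriod_anyLevel)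
    (hBDP : bertoliniDarmonPrasanna2013_centralValue_reciprocity)
    (hW : MordellShaFreeCutBDPWaldspurgerFormula.BDPWaldspurgerFormula 3)
    (hERL : MordellShaFreeCutKatoBDPReciprocity.ThreeAdicKatoBDPReciprocity) :
    AnalyticRankOneOfRankOneFiniteShaThree :=
  cruxB_of_nineFacts_of_anyLevel_of_bdp2013_of_waldspurger_of_reciprocity RI.1 RI.2.1 RI.2.2.1 RI.2.2.2.1
    RI.2.2.2.2.1 RI.2.2.2.2.2.1 RI.2.2.2.2.2.2 hT1 hBDP hW hERL

end Summit.BirchSwinnertonDyer.BirchSwinnertonDyer.Theorems.MordellShaFreeCutKatoZetaRoadSevenFactsCensus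

end
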